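/-
Copyright: the b2b-balaban cell (near-miss cell 7), T⁴-continuum fan-out, round-2 swarm seat t4-ne7b-formalise-leaf-09
(row S3 of the lineage t4-ne7b-p1's claim table `t4/b2b-balaban-t4-ne7b-p1/LEAVES-NE7b.md`; node U5c COUNT member).
Released under the licence of the surrounding project.
-/
import Summits.QuantumFields.BalabanUV.T4Continuum.Support.HistoryGen

/-!
# History genealogies, part 3: the root region, names and forests, freshness of the tags

Summits-side support leaf of the T⁴-continuum cell (rung (B)+1 on a FINITE torus only; NOT infinite volume, NOT the
mass gap, NOT the Clay statement; NOT a proof of the spine estimate NE7b).  Round-2 swarm `t4-ne7b-formalise-*`, row S3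
«H2a the genealogy of a live component» (claim table `t4/b2b-balaban-t4-ne7b-p1/LEAVES-NE7b.md`, seat leaf-09); part 3
(parts 1–2: `Support/HistoryChain.lean`, `Support/HistoryGen.lean`; the instantiation on row S1's `AdmissibleHistory`
follows S1).  [folklore] finite bookkeeping over the lineage's OWN carrier; nothing is quoted from print, nothing
printed is asserted; no `[cite:]` tag; `Forest` is a parametrised predicate, not a fact.

WHAT.  For the tagged genealogy `Pedigree.genT c` of part 2:
* §1 `Tag.comp` ∕ `Tag.idx` ∕ `Tag.isMer` — the component, part∕merger index and kind of a tag.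
* §2 **THE ROOT IS A CONSTITUENT REGION OF THE ROOT STEP** (print's `j(Z)` «the index of a first large field region
  contained in Z», B16 p. 384, READ): `root_genT_spec` ∕ `rootData` ∕ `rootData_spec` — for a pedigree whose components
  all have parts, the root label of `genT c` is the birth label `((step c′, 0, d′), birth c′ i d′ x)` of a NEW part of a
  component `c′` with `rootStep (genT c) = step c′`, and `rootData c = some (c′, i, d′, x)` hands rows S6∕S7 the root
  REGION's record `x` (root cell ∕ zone of the component — a function of the component, typer T-NE7b-1);
  `root_gen_eq`: the flat root is `(rootStep, 0, d′)`.
* §3 `names c` — the ancestry of `c` (itself and, recursively, its old parts' ancestries; WF recursion, `names_eq`),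
  `step_le_of_mem_names`.
* §4 `comp_mem_names_of_mem_events` — every event of `genT c` is tagged by a name of the ancestry, hence by a component
  of no later step (`step_comp_le_of_mem_events`); a label tagged by `c` is no event of an old part's line.
* §5 `Forest c` (old parts at different positions of `parts c` have disjoint ancestries — in print: a component of step
  `j` lies in exactly one component of step `j+1`) and **`freshT_genT : (∀ c, Forest c) → LateMergers.FreshT (genT c)`**:
  the tags of a forest pedigree are FRESH (new at every renewal, disjoint at every merger) with NO hypothesis on the
  shapes — the label half of `Gen.WF` that row S4's `HistoryConsistent.wf_shape` consumes next to `ConsistentT` (timing,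
  S4) and the displayed shape-injectivity `TypeNodup` (owner's ruling, LEAVES-NE7b.md v1.5); `card_events_gen_of_injOn`.

NOT DONE HERE.  Timing (`ConsistentT`, pendency), zones, slots; the S1 adapter.  NE7b discharge: no date.

HONEST DEPENDENCY (cell): continuum YM on T⁴ ⇐ BetaPertH ∧ nine spine estimates (0/9 proved); BetaPertH ⇐ (D1) ∧ (D4)
∧ CAP+tail.  This file changes none of it.
-/

open Finset
open Literature.MathematicalPhysics.QuantumFieldTheory.Balaban1983to89
open T4PersistenceDictionary
open Summit.QuantumFields.BalabanUV.T4Continuum.ZoneSkeleton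
open Summit.QuantumFields.BalabanUV.T4Continuum.HistoryChrono
open Summit.QuantumFields.BalabanUV.T4Continuum.LateMergers

namespace Summit.QuantumFields.BalabanUV.T4Continuum.HistoryGen

variable {α π : Type*}

/-! ## §1 Tags: component and index -/

/-- the component a tag belongs to [folklore] -/
def Tag.comp : Tag α π → α
  | Tag.birth c _ _ _ => c
  | Tag.ren c _ => c
  | Tag.mer c _ => c

/-- the index of a tag (part index for births and renewals, merger index for mergers) [folklore] -/
def Tag.idx : Tag α π → ℕ
  | Tag.birth _ i _ _ => i
  | Tag.ren _ i => i
  | Tag.mer _ i => i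

/-- merger tags [folklore] -/
def Tag.isMer : Tag α π → Bool
  | Tag.mer _ _ => true
  | _ => false

namespace Pedigree

section Root

variable (P : Pedigree α π)

/-! ## §2 The root: a constituent region of the root step -/

/-- **THE ROOT OF THE GENEALOGY IS THE BIRTH OF A CONSTITUENT REGION** of the root step (print's `j(Z)`: «the index of a
first large field region contained in Z», p. 384, READ): for a pedigree all of whose components have parts, the root
label of `genT c` is the birth label `((step c′, 0, d′), birth c′ i d′ x)` of a new part `new d′ x` of some component
`c′`, and `rootStep (genT c) = step c′`. [folklore] -/
theorem root_genT_spec (hP : ∀ c, P.parts c ≠ []) (c : α) :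
    ∃ c' i d x, Part.new d x ∈ P.parts c' ∧
      (P.genT c).root = (((P.step c', 0, d) : PEv), Tag.birth c' i d x) ∧ (P.genT c).rootStep = P.step c' := by
  rw [genT_eq]
  unfold partsGen
  cases hps : P.parts c with
  | nil => exact absurd hps (hP c)
  | cons p ps =>
      rw [partsGenAux_cons]
      obtain ⟨H, hH, hr, hs⟩ :=
        exists_root_chainMerge (P.partGen c P.genT 0 p) (P.partsGenAux c P.genT (0 + 1) ps) (P.merLab c)
      have hH' : H ∈ P.partsGenAux c P.genT 0 (p :: ps) := by rwa [partsGenAux_cons]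
      obtain ⟨k, q, hq, rfl⟩ := P.mem_partsGenAux hH'
      change (chainMerge _ _ _).root = _ at hr
      change (chainMerge _ _ _).rootStep = _ at hs
      simp only [join]
      rw [hr, hs]
      rcases q with ⟨c'', r⟩ | ⟨d, x⟩
      · have hlt : P.step c'' < P.step c := P.step_lt c c'' r (by rw [hps]; exact hq)
        obtain ⟨c', i, d, x, hm, hroot, hstep⟩ := root_genT_spec hP c''
        refine ⟨c', i, d, x, hm, ?_, ?_⟩
        · rw [root_partGen]; rcases r with _ | _ <;> exact hroot
        · rw [rootStep_partGen]; rcases r with _ | _ <;> exact hstep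
      · exact ⟨c, 0 + k, d, x, by rw [hps]; exact hq, by rw [root_partGen], by rw [rootStep_partGen]⟩
termination_by P.step c
decreasing_by exact hlt

/-- **THE ROOT DATA** of the genealogy of `c`: the component, part index, class and payload of the root birth label
(`none` on the junk label of a partless component). [folklore] -/
def rootData (c : α) : Option (α × ℕ × ℕ × π) :=
  match (P.genT c).root.2 with
  | Tag.birth c' i d x => some (c', i, d, x)
  | _ => none

/-- for a pedigree all of whose components have parts, the root data exist and describe a new part of a component of
the root step, whose birth label is the root [folklore] -/
theorem rootData_spec (hP : ∀ c, P.parts c ≠ []) (c : α) :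
    ∃ c' i d x, P.rootData c = some (c', i, d, x) ∧ Part.new d x ∈ P.parts c' ∧
      (P.genT c).root = (((P.step c', 0, d) : PEv), Tag.birth c' i d x) ∧ (P.genT c).rootStep = P.step c' := by
  obtain ⟨c', i, d, x, hm, hr, hs⟩ := P.root_genT_spec hP c
  exact ⟨c', i, d, x, by simp [rootData, hr], hm, hr, hs⟩

/-- the flat root is the birth event `(rootStep, 0, d′)` of the root region's class [folklore] -/
theorem root_gen_eq (hP : ∀ c, P.parts c ≠ []) (c : α) :
    ∃ c' i d x, P.rootData c = some (c', i, d, x) ∧ (P.gen c).root = ((P.gen c).rootStep, 0, d) := by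
  obtain ⟨c', i, d, x, hd, -, hr, hs⟩ := P.rootData_spec hP c
  exact ⟨c', i, d, x, hd, by rw [root_gen, rootStep_gen, hr, hs]⟩

end Root

variable [DecidableEq α]

/-! ## §3 The names of a component's ancestry -/

/-- names occurring in a list of parts, the old parts' ancestries read off `rec` [folklore] -/
def namesAux (rec : α → Finset α) : List (Part α π) → Finset α
  | [] => ∅
  | Part.old c' _ :: ps => rec c' ∪ namesAux rec ps
  | Part.new _ _ :: ps => namesAux rec ps

/-- membership in `namesAux` [folklore] -/
theorem mem_namesAux {rec : α → Finset α} {a : α} :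
    ∀ {ps : List (Part α π)}, a ∈ namesAux rec ps ↔ ∃ c' r, Part.old c' r ∈ ps ∧ a ∈ rec c'
  | [] => by simp [namesAux]
  | Part.old c' r :: ps => by
      rw [namesAux, mem_union, mem_namesAux]
      constructor
      · rintro (h | ⟨c'', r', hm, ha⟩)
        · exact ⟨c', r, List.mem_cons_self, h⟩
        · exact ⟨c'', r', List.mem_cons_of_mem _ hm, ha⟩
      · rintro ⟨c'', r', hm, ha⟩
        rcases List.mem_cons.1 hm with h | h
        · cases h; exact Or.inl ha
        · exact Or.inr ⟨c'', r', h, ha⟩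
  | Part.new d x :: ps => by
      rw [namesAux, mem_namesAux]
      constructor
      · rintro ⟨c'', r', hm, ha⟩; exact ⟨c'', r', List.mem_cons_of_mem _ hm, ha⟩
      · rintro ⟨c'', r', hm, ha⟩
        rcases List.mem_cons.1 hm with h | h
        · cases h
        · exact ⟨c'', r', h, ha⟩

/-- `namesAux` depends on `rec` only through the old parts listed [folklore] -/
theorem namesAux_congr {rec rec' : α → Finset α} :
    ∀ {ps : List (Part α π)}, (∀ c' r, Part.old c' r ∈ ps → rec c' = rec' c') →
      namesAux rec ps = namesAux rec' ps
  | [], _ => rfl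
  | Part.old c' r :: ps, h => by
      rw [namesAux, namesAux, h c' r List.mem_cons_self,
        namesAux_congr fun c'' r' hm => h c'' r' (List.mem_cons_of_mem _ hm)]
  | Part.new d x :: ps, h => by
      rw [namesAux, namesAux, namesAux_congr fun c'' r' hm => h c'' r' (List.mem_cons_of_mem _ hm)]

variable (P : Pedigree α π)

/-- **THE NAMES OF THE ANCESTRY** of `c`: `c` itself and, recursively, the ancestries of its old parts. [folklore] -/
def names (c : α) : Finset α :=
  insert c (namesAux (fun c' => if _h : P.step c' < P.step c then names c' else ∅) (P.parts c))
termination_by P.step c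
decreasing_by exact _h

/-- **UNFOLDING** of `names` [folklore] -/
theorem names_eq (c : α) : P.names c = insert c (namesAux P.names (P.parts c)) := by
  rw [names, namesAux_congr fun c' r hm => dif_pos (P.step_lt c c' r hm)]

/-- a component names itself [folklore] -/
theorem mem_names_self (c : α) : c ∈ P.names c := by rw [names_eq]; exact mem_insert_self _ _

/-- the ancestry of an old part is part of the ancestry [folklore] -/
theorem names_subset_of_old {c c' : α} {r : Bool} (h : Part.old c' r ∈ P.parts c) : P.names c' ⊆ P.names c := by
  intro a ha
  rw [names_eq, mem_insert]
  exact Or.inr (mem_namesAux.2 ⟨c', r, h, ha⟩)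

/-- membership in the ancestry: `c` itself or a member of an old part's ancestry [folklore] -/
theorem mem_names_iff {c a : α} : a ∈ P.names c ↔ a = c ∨ ∃ c' r, Part.old c' r ∈ P.parts c ∧ a ∈ P.names c' := by
  rw [names_eq, mem_insert, mem_namesAux]

/-- **NAMES ARE OF NO LATER STEP** [folklore] -/
theorem step_le_of_mem_names (c : α) : ∀ a ∈ P.names c, P.step a ≤ P.step c := by
  intro a ha
  rcases (P.mem_names_iff).1 ha with rfl | ⟨c', r, hm, ha'⟩
  · exact le_rfl
  · have hlt := P.step_lt c c' r hm
    exact (step_le_of_mem_names c' a ha').trans hlt.le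
termination_by P.step c
decreasing_by exact hlt

/-! ## §4 Where the events of a genealogy are tagged -/

variable [DecidableEq π]

/-- events of a part genealogy: the part's own label(s), tagged by `c` and the part index, or events of the old line
[folklore] -/
theorem mem_events_partGen_cases {c : α} {rec : α → Gen (Lab α π)} {i : ℕ} {p : Part α π} {e : Lab α π}
    (he : e ∈ (P.partGen c rec i p).events) :
    (e.2.comp = c ∧ e.2.idx = i ∧ e.2.isMer = false) ∨ ∃ c' r, p = Part.old c' r ∧ e ∈ (rec c').events := by
  rcases p with ⟨c', _ | _⟩ | ⟨d, x⟩
  · exact Or.inr ⟨c', false, rfl, he⟩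
  · simp only [partGen, Gen.events_renew, mem_insert] at he
    rcases he with rfl | he
    · exact Or.inl ⟨rfl, rfl, rfl⟩
    · exact Or.inr ⟨c', true, rfl, he⟩
  · simp only [partGen, Gen.events_born, mem_singleton] at he
    subst he
    exact Or.inl ⟨rfl, rfl, rfl⟩

/-- **EVERY EVENT OF `genT c` IS TAGGED BY A NAME OF THE ANCESTRY OF `c`.** [folklore] -/
theorem comp_mem_names_of_mem_events (c : α) : ∀ e ∈ (P.genT c).events, e.2.comp ∈ P.names c := by
  intro e he
  rw [genT_eq] at he
  unfold partsGen at he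
  cases hps : P.parts c with
  | nil =>
      rw [hps, partsGenAux_nil] at he
      simp only [join, Gen.events_born, mem_singleton] at he
      subst he; exact P.mem_names_self c
  | cons p ps =>
      rw [hps, partsGenAux_cons, mem_events_join] at he
      rcases he with ⟨H, hH, he⟩ | ⟨i, -, rfl⟩
      · rw [← partsGenAux_cons] at hH
        obtain ⟨k, q, hq, rfl⟩ := P.mem_partsGenAux hH
        rcases P.mem_events_partGen_cases he with ⟨hc, -, -⟩ | ⟨c', r, rfl, he'⟩
        · rw [hc]; exact P.mem_names_self c
        · have hq' : Part.old c' r ∈ P.parts c := by rw [hps]; exact hq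
          have hlt := P.step_lt c c' r hq'
          exact P.names_subset_of_old hq' (comp_mem_names_of_mem_events c' e he')
      · exact P.mem_names_self c
termination_by P.step c
decreasing_by exact hlt

/-- hence every event of `genT c` is tagged by a component of no later step [folklore] -/
theorem step_comp_le_of_mem_events (c : α) {e : Lab α π} (he : e ∈ (P.genT c).events) :
    P.step e.2.comp ≤ P.step c :=
  P.step_le_of_mem_names c _ (P.comp_mem_names_of_mem_events c e he)

/-- a label tagged by `c` itself is not an event of an old part's line [folklore] -/
theorem not_mem_events_of_comp_eq {c c' : α} {r : Bool} (h : Part.old c' r ∈ P.parts c) {e : Lab α π}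
    (hc : e.2.comp = c) : e ∉ (P.genT c').events := fun he => by
  have := P.step_comp_le_of_mem_events c' he
  rw [hc] at this
  exact absurd (P.step_lt c c' r h) (not_lt.2 this)

/-! ## §5 Forests and the freshness of the tagged genealogy -/

/-- **FOREST** at `c`: two old parts at different positions of the part list of `c` have DISJOINT ancestries (in
print: a component of step `j` is part of exactly one component of step `j + 1`, and the constituents of distinct
components are distinct).  A parametrised predicate, not a fact. [folklore] -/
def Forest : α → Prop := fun c =>
  (P.parts c).Pairwise fun p q =>
    ∀ c₁ r₁ c₂ r₂, p = Part.old c₁ r₁ → q = Part.old c₂ r₂ → Disjoint (P.names c₁) (P.names c₂)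

variable {P}

/-- two part genealogies of one component at different indices, with disjoint old ancestries, have disjoint events
[folklore] -/
theorem disjoint_events_partGen {c : α} {i j : ℕ} (hij : i ≠ j) {p q : Part α π} (hp : p ∈ P.parts c)
    (hq : q ∈ P.parts c)
    (hpq : ∀ c₁ r₁ c₂ r₂, p = Part.old c₁ r₁ → q = Part.old c₂ r₂ → Disjoint (P.names c₁) (P.names c₂)) :
    Disjoint (P.partGen c P.genT i p).events (P.partGen c P.genT j q).events := by
  rw [Finset.disjoint_left]
  intro e hep heq
  rcases P.mem_events_partGen_cases hep with ⟨hc, hi, -⟩ | ⟨c₁, r₁, rfl, he₁⟩ <;>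
    rcases P.mem_events_partGen_cases heq with ⟨hc', hj, -⟩ | ⟨c₂, r₂, rfl, he₂⟩
  · exact hij (hi.symm.trans hj)
  · exact P.not_mem_events_of_comp_eq hq hc he₂
  · exact P.not_mem_events_of_comp_eq hp hc' he₁
  · exact Finset.disjoint_left.1 (hpq c₁ r₁ c₂ r₂ rfl rfl) (P.comp_mem_names_of_mem_events c₁ e he₁)
      (P.comp_mem_names_of_mem_events c₂ e he₂)

/-- the part genealogies of a forest-like part list have pairwise disjoint events [folklore] -/
theorem pairwise_disjoint_partsGenAux {c : α} :
    ∀ (i : ℕ) (ps : List (Part α π)), (∀ p ∈ ps, p ∈ P.parts c) →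
      ps.Pairwise (fun p q => ∀ c₁ r₁ c₂ r₂, p = Part.old c₁ r₁ → q = Part.old c₂ r₂ →
        Disjoint (P.names c₁) (P.names c₂)) →
      (P.partsGenAux c P.genT i ps).Pairwise fun G H => Disjoint G.events H.events
  | _, [], _, _ => List.Pairwise.nil
  | i, p :: ps, hsub, hpw => by
      rw [List.pairwise_cons] at hpw
      rw [partsGenAux_cons, List.pairwise_cons]
      refine ⟨fun H hH => ?_, pairwise_disjoint_partsGenAux (i + 1) ps (fun q hq => hsub q (List.mem_cons_of_mem _ hq))
        hpw.2⟩
      obtain ⟨k, q, hq, rfl⟩ := P.mem_partsGenAux hH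
      exact disjoint_events_partGen (by omega) (hsub p List.mem_cons_self) (hsub q (List.mem_cons_of_mem _ hq))
        (hpw.1 q hq)

/-- **THE TAGGED GENEALOGY OF A COMPONENT OF A FOREST IS FRESH** (`LateMergers.FreshT`: at every renewal the new label
is new, at every merger the partners' labels are disjoint and the merger label new) — the label half of `Gen.WF`, with
NO hypothesis on the shapes. [folklore] -/
theorem freshT_genT (hF : ∀ c, P.Forest c) (c : α) : FreshT (P.genT c) := by
  rw [genT_eq]
  -- the part genealogies are fresh
  have hmem : ∀ (k : ℕ) (q : Part α π), q ∈ P.parts c → FreshT (P.partGen c P.genT k q) := by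
    intro k q hq
    rcases q with ⟨c', r⟩ | ⟨d, x⟩
    · have hlt := P.step_lt c c' r hq
      have ih := freshT_genT hF c'
      rcases r with _ | _
      · exact ih
      · exact ⟨ih, P.not_mem_events_of_comp_eq hq rfl⟩
    · trivial
  unfold partsGen
  cases hps : P.parts c with
  | nil => trivial
  | cons p ps =>
      have hsub : ∀ q ∈ p :: ps, q ∈ P.parts c := fun q hq => by rw [hps]; exact hq
      have hpw := pairwise_disjoint_partsGenAux (P := P) 0 (p :: ps) hsub (by rw [← hps]; exact hF c)
      rw [partsGenAux_cons, List.pairwise_cons] at hpw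
      rw [partsGenAux_cons]
      refine freshT_chainMerge (hmem 0 p (hsub p List.mem_cons_self)) (fun H hH => ?_) hpw.1 hpw.2 (fun i _ => ?_)
        (fun i j _ _ hij => ?_)
      · obtain ⟨k, q, hq, rfl⟩ := P.mem_partsGenAux hH
        exact hmem _ q (hsub q (List.mem_cons_of_mem _ hq))
      · have key : ∀ (k : ℕ) (q : Part α π), q ∈ P.parts c → P.merLab c i ∉ (P.partGen c P.genT k q).events := by
          intro k q hq hm
          rcases P.mem_events_partGen_cases hm with ⟨-, -, h⟩ | ⟨c', r, rfl, he⟩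
          · exact Bool.noConfusion h
          · exact P.not_mem_events_of_comp_eq hq rfl he
        refine ⟨key 0 p (hsub p List.mem_cons_self), fun H hH => ?_⟩
        obtain ⟨k, q, hq, rfl⟩ := P.mem_partsGenAux hH
        exact key _ q (hsub q (List.mem_cons_of_mem _ hq))
      · simpa [merLab] using hij
termination_by P.step c
decreasing_by exact hlt

/-- … so is the flat genealogy's tag structure: `FreshT` transports along `gmap Prod.fst` exactly when the shapes of ONE
genealogy's events are distinct (`TypeNodup`, the owner's displayed restriction) — recorded here as the statement row
S4 consumes: under `Set.InjOn Prod.fst (genT c).events` the flat events are the image WITHOUT collisions. [folklore] -/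
theorem card_events_gen_of_injOn {c : α} (h : Set.InjOn Prod.fst ((P.genT c).events : Set (Lab α π))) :
    (P.gen c).events.card = (P.genT c).events.card := by
  rw [events_gen]; exact card_image_of_injOn h

end Pedigree

end Summit.QuantumFields.BalabanUV.T4Continuum.HistoryGen
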